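import Summits.AtomisticToContinuum.Crystallization.Theorems.ChartedPlanarOrderSparseNullOfMeasurable
import Summits.AtomisticToContinuum.Crystallization.Theorems.PalmUnimodularRigidityBenjaminiSchrammLimitEmbedding

/-!
# `SparseNull` from Borel measurability of the matched-root event ON CONFIGURATION SPACE (decomp-a2c lens-3 g21; def-free helper for hand-1 g8)

Critic row 368 (1): `SparseNull ν` (g20, `ChartedPlanarOrderRigidityDoor.SparseNull`) ⟸ a measurable version of `{μ | matchedAt ν μ 0}` on rooted
`δ`-hard-core configurations (hand-1 p812751 `sparseNull_of_measurable_version`).  This file TRANSPORTS the question to the compact metric space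
`RootedHardCoreConfig E3 δ` of rooted hard-core configurations (local rubber topology): if the event `{S | matchedAt ν count|S 0}` is Borel there, the
image under the measurable EMBEDDING `S ↦ count|S` (`BenjaminiSchrammLimit.measurableEmbedding_toMeasure`, Lusin–Souslin) is the required measurable
version.  What remains for hand-1 g8 is the Borel (F_σ) argument on configuration space — plan in HOME/decomp-a2c-lens-3/g21/NODE-LaminarCut.md §5
(the `≤ ν` event is NOT closed: template points of norm exactly `5b` exist for all parameters, `i² + ij + j² = 25`; use strict radii + a rational margin).
Def-free; axioms standard.
-/

noncomputable section

open MeasureTheory Set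
open Summit.AtomisticToContinuum.Crystallization.Theorems.ChartedPlanarOrderRigidityDoor

namespace Summit.AtomisticToContinuum.Crystallization.Theorems.ChartedPlanarOrderMatchedRootTransport

/-- **Transport**: a Borel matched-root event on `RootedHardCoreConfig E3 δ` (every `δ > 0`) yields the measurable version asked by
`sparseNull_of_measurable_version`. [folklore] -/
theorem measurable_version_of_measurableSet_config (ν : ℝ)
    (h : ∀ δ : ℝ, 0 < δ → MeasurableSet {S : Literature.Probability.Process.LocalConfig.RootedHardCoreConfig E3 δ |
      matchedAt ν (S.1 : Literature.Probability.Process.LocalConfig E3).toMeasure 0}) :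
    ∀ δ : ℝ, 0 < δ → ∃ M : Set (Measure E3), MeasurableSet M ∧
      ∀ μ : Measure E3, Literature.Probability.Process.IsRootedHardCore δ μ → (μ ∈ M ↔ matchedAt ν μ 0) := by
  intro δ hδ
  haveI : Fact (0 < δ) := ⟨hδ⟩
  let f : Literature.Probability.Process.LocalConfig.RootedHardCoreConfig E3 δ → Measure E3 :=
    fun S => (S.1 : Literature.Probability.Process.LocalConfig E3).toMeasure
  have hf : MeasurableEmbedding f :=
    Summit.AtomisticToContinuum.Crystallization.Theorems.BenjaminiSchrammLimit.measurableEmbedding_toMeasure E3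
  refine ⟨f '' {S | matchedAt ν (f S) 0}, hf.measurableSet_image.2 (h δ hδ), fun μ hμ => ?_⟩
  obtain ⟨S₀, h0, hsep, rfl⟩ := hμ
  let S : Literature.Probability.Process.LocalConfig.RootedHardCoreConfig E3 δ :=
    ⟨Literature.Probability.Process.LocalConfig.mk S₀, h0, hsep⟩
  have hS : f S = (Measure.count : Measure E3).restrict S₀ := rfl
  constructor
  · rintro ⟨S', hS', hEq⟩
    rw [← hEq]
    exact hS'
  · intro hm
    exact ⟨S, by rw [Set.mem_setOf_eq, hS]; exact hm, hS⟩

/-- **`SparseNull ν` from Borel measurability of the matched-root event on configuration space** (composition with hand-1 p812751). [folklore] -/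
theorem sparseNull_of_measurableSet_config (ν : ℝ)
    (h : ∀ δ : ℝ, 0 < δ → MeasurableSet {S : Literature.Probability.Process.LocalConfig.RootedHardCoreConfig E3 δ |
      matchedAt ν (S.1 : Literature.Probability.Process.LocalConfig E3).toMeasure 0}) : SparseNull ν :=
  Summit.AtomisticToContinuum.Crystallization.Theorems.ChartedPlanarOrderSparseNullOfMeasurable.sparseNull_of_measurable_version ν
    (measurable_version_of_measurableSet_config ν h)

end Summit.AtomisticToContinuum.Crystallization.Theorems.ChartedPlanarOrderMatchedRootTransport

end
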